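import Literature.MathematicalPhysics.QuantumFieldTheory.Balaban1983to89.Node00.TorusCoverLocalGauge10

/-!
# NODE 00 — THE TORUS→`ℤᵈ` TWIN, (152)₄ + (153): [15] Sect. F's LAPLACIAN MEMBER «(L^jη)³|Δ^ηA| < 9dL²B₁Mε₀» ([6] (1.136)₄) AND GAUGE CONDITION «R ∂^{η*}A = 0»
# ([6] (1.38) «R(U₀)D^{η*}_{U₀}A = 0» at the trivial background) CARRIED THROUGH FILE 3b's `SU(N)` CORRECTION AND 34b's CUBE PUSH-DOWN — the gauge condition in N05's `ℤᵈ`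
# multiplier currency `B8Eq138LandauZd.IsLandau138`, the Laplacian member in r11's `grad` letters on the torus

Cell `pub-ymgap`, width seat `pub-ymgap-dag-n07-w3` generation 0 (HUMAN RULING D-0149 ∕ director-ym №197; DAG node N07 = [15]; plan g77 W-SEAT-START-LIST v3 § n07 item S3
«(145)–(156) at objects on the collared cube … (153) gauge-condition token … push through the cover as 34a∕34b did»; cell INBOX INTENT-1 of 2026-08-27, AUDIT-S3).  NEW leaf,
PROOF kind (no `def`); CONSUMED BY NAME, nothing modified: N05's `B8Eq138LandauZd` (`IsLandau138`, `IsLandau138W`, `covDivB`, `covLap`, `qprimeT1`, `QprimeT`, `QT`, `logCfg`),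
node00-def-cube's `Node00.CarriersB8Cube` (`GaugedBoundB8` — whose FOURTH conjunct `IsLandau138W L c.k η (c.sq 0) c.lamS 1 (c.fixed U₀ u)` is print's (1.38) ∕ (153) at the member and
whose TENTH conjunct is (1.136)₄ — `CubeB8`, `CubeB8.expo`, `zdCub`, `prop6Printed_zdCub_iff`), FILE 3b `Node00.TorusCoverSUGauge` (`traceless`, `exists_suGauge_of_unitaryGauge`,
`norm_traceless_le`, `norm_traceless_sub_le`), 34a `Node00.TorusCoverPropSixGauge10` (`covDeriv_one_apply`, `traceless_add`, `traceless_smul_real`, `traceless_sub'`,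
`pdiv_plaqCovDeriv_one_traceless`, `bondTouches_sq_top_of_mem_box`, `norm_codiff_logCfg_le`), FILE 28a `Node00.TorusCoverPropSixGauge` (`sideTouches_sq_top_of_mem_box`,
`mlogCfg_eq_logCfg_of_mem_box`, `norm_mlogCfg_le_of_sides`, `norm_sub_le_of_msup_grad`), lit-balaban's `B8ScaledSupNorm` (`Bdd`, `weight`, `bondNorm`, `norm_le_of_msup_le`,
`scale_pos`), n05-a's `B8LeafModelZd3.mlogCfg`, 34b `Node00.TorusCoverLocalGauge10` (`codiffCurlA_cover_eq_pdiv`,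
`sub_e_mem_cubeExt_of_unshift_mem_image`), FILES 25∕26∕28b (`zdLift`, `cover_add_e`, `cover_sub_e`, `inAk_zdLift_of_top`, `cubeIdx'`, `propCube`, `tol_of_level_pred`,
`cubeExt_subset_box_propCube`, `box_subset_tcube_of_le`, `eq_of_cover_eq_of_mem_cubeExt`, `add_e_mem_cubeExt_of_shift_mem_image`, `cfgExp_eq_expI`,
`zdLift_mem_specialUnitaryUnits`), 33b (`Sect2.codiffCurlA`, `Sect2.bondsDeep`), r15's `cover`, def-R's `cubeEnl`, def-P11's `Sect2.regionOfSet`, r11's `gaugeU ∕ expI ∕ grad`,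
lit-balaban's `B7Eq78Linearization.conjR`, `B8Ineq132.covDeriv ∕ covDerivFwd`.  `--kind proof --supports stmt-QuantumFields-20542 --as helper` (K1⁷; count-neutral).
[15] = [Balaban1985Variational]; [6] = [Balaban1985RegularSpaces]; B9 = [Balaban1985BackgroundPropagators].

WHY.  [15] p. 301: «Now we apply Theorem 2 of the paper [6] to the pair of configurations U′_k, 1 … there exists a unique gauge transformation u satisfying the restrictions
ū_j = 1 on Λ″_j, and such that L^jη|A|, (L^jη)²|∇^ηA|, (L^jη)³|∂^{η*}∂^ηA|, (L^jη)³|Δ^ηA| < 9dL²B₁Mε₀ on Ω″_j (152); R ∂^{η*}A = 0, (153) where the operator R is defined for the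
sequence {Ω″_j}».  The K0 road's (152) tokens (FILE 29, 34a∕34b∕34c) carry the three sup letters of (152) from N05's member sentence `B8.Prop6Printed … zdCub` through the torus
cover — the Laplacian member (152)₄ ∕ (1.136)₄ (the TENTH conjunct `bondNorm L k η (−3) □• (fun x μ => covLap η 1 (Ã · μ) x) ≤ r` of `Node00.GaugedBoundB8`) is «extractable the
same way (not done)» (n07-e's STUB1-SECTF-MAP row (152)); the gauge CONDITION (153) — on `ℤᵈ` the fourth conjunct `IsLandau138W L c.k η (c.sq 0) c.lamS 1 (c.fixed U₀ u)` of
`Node00.GaugedBoundB8` ([6] (1.138), typed by N05 in the multiplier form «Δ^η↾Ω₀(D^{η*}A) = Q′ᵀμ on Ω₀» of `B8Eq138LandauZd`) — is DROPPED by 34a's extraction, and nothing on the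
torus side names it.  (153) is what [15] uses to derive (143)∕(158) from (111) (p. 300: «it does not imply necessarily that solutions satisfy the Landau gauge condition, which
was used in the derivation of (143)»), i.e. an input of Sect. F's heart (157)–(159) at objects; (152)₄ is [15] Thm 1 (10)'s second member.  THIS FILE carries both as far as
the existing twin vocabulary allows, WITHOUT choosing a torus-native `R`: (§1) the multiplier form is stable under FILE 3b's `SU(N)` normalisation `A ↦ A − (Re tr A ∕ N)·1`
(every stencil of (1.38) — `D^{η*}_{U₀}`, `Δ^η_{U₀}`, the Dirichlet cut-off, `Q′(U₀)ᵀ` — is conjugation-equivariant and `ℝ`-linear, at ANY background); (§1b–§1c) the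
Laplacian `Δ^η = D^{η*}D^η` at background `1`: closed form, size, locality, and the (1.136)₄ member of `GaugedBoundB8` read pointwise inside `□` (34a's pattern for (1.136)₃);
(§2) 34a's box extraction with the fifth conclusion «`‖(Δ^ηÃ_μ)(x)‖ ≤ 2r((Lᵏη)³)⁻¹` whenever `x, x ± e_ν ∈ □`» and the sixth «`Ã` satisfies (1.38) for `(□₀, {Λ′_j})` at
background `1`», for the SAME potential `Ã`; (§3) 34b's push-down to one grid cube of the torus with the two corresponding clauses — the Laplacian member on 33b's deep bonds
in r11's `grad` letters (`Σ_ν η_n⁻¹[(∇^{η_n}_νA_μ)(x − e_ν) − (∇^{η_n}_νA_μ)(x)]`, inline; a named torus letter is left to the definition lane), and «the cube potential `A` is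
the `cover`-push-forward of a `ℤᵈ` potential `A′` in the (153)-gauge of the Prop.-6 cube tower `{□_j}` (largest cube `□₀ = c.sq 0`)».

CONTENTS.  §1 `conjR_traceless`, `traceless_zero'`, `covDeriv_traceless`, `covDerivFwd_traceless`, `covDivB_traceless`, `covLap_traceless`, `indicator_traceless`,
`qprimeT1_traceless`, `QprimeT_traceless`, `QT_traceless`, ★ `isLandau138_traceless`.  §1b `covDerivFwd_one_apply`, `covLap_one_apply`, `norm_covLap_one_le`, `covLap_one_congr`.
§1c `bdd_lapFamily_of_sides`, `norm_lap_mlogCfg_le`, `norm_lap_logCfg_le`.  §2 ★★ `exists_suGauge_letters152_153_of_gaugedBoundB8`.  §3 `lap_cover_eq_covLap`,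
★★ `exists_localGauge152_153_cube_of_prop6`.

HONEST FRAMING: bookkeeping (linear algebra of the (1.38) stencils + a composition by name); [6] Proposition 6 at the member is the HYPOTHESIS `hG` ∕ `hP6` (N05's node; never
asserted here); (153) is carried in N05's `ℤᵈ` multiplier currency on the largest cube `□₀ = c.sq 0` of the Prop.-6 tower `{□_j}` ((144); the Dirichlet domain of N05's
`IsLandau138W` conjunct; it strictly contains `cover⁻¹` of the grid cube), the torus potential being the restriction of its lift — NO torus-native operator `R` is defined or claimed (that needs the level-`j` block structure of `Site P 0` under `cover`, deferred to the
seat that types (157)∕(158) at objects); nothing of Bałaban discharged; N07 ∕ N05 ∕ K0⁷ ∕ K1⁷ NOT closed; counts unmoved (5∕27); one finite T⁴ programme at fixed ε — NOT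
continuum ∕ ℝ⁴ ∕ infinite volume ∕ OS ∕ mass gap ∕ Clay.  No `sorry`, no `def`, no `instance`, no `notation`.
-/

noncomputable section

namespace Literature.MathematicalPhysics.QuantumFieldTheory.Balaban1983to89.Node00

open scoped Matrix.Norms.L2Operator
open Complex (I)
open B7Prop1Explicit (e e_apply)
open B7Prop1Local (InBox AgreeOn)
open B7Prop2Explicit (unitaryUnits mem_unitaryUnits)
open B7Prop2SpecialUnitary (specialUnitaryUnits mem_specialUnitaryUnits)
open B7Eq78Linearization (conjR conjR_apply)
open B8Ineq132 (covDerivFwd covDeriv BondTouches)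
open B8Eq131Cubes (box cube tcube tLo tHi bLo bHi)
open B8Eq140Level (SideTouches)
open B8Eq138LandauZd (logCfg covDivB covLap qprimeT1 QprimeT QT IsLandau138 IsLandau138W)
open B8Eq184Proof (cfgExp)
open B8LeafModelZd3 (mlogCfg)
open B8ScaledSupNorm (msup Bdd bondNorm)
open B8Eq146AExpansion (plaqCovDeriv plaqCovDeriv_eq_covDerivFwd)
open B8Eq143PlaqExpansion (pdiv)
open B15Eq112TorusCover (cover)
open B14DomainGeom (Pt)
open B14.Eq213MaximalDomains (side cubeExt)
open B12RegularSpaces111 (gaugeU expI grad)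
open B8LeafModelZd (ZdIdx)
open B8Ineq132 (InAk)

variable {d N : ℕ} [NeZero N]

/-! ## §1  The (1.38) stencils commute with the traceless `SU(N)` correction (any background) -/

section Traceless

omit [NeZero N] in
/-- The traceless part of a conjugate is the conjugate of the traceless part: `tr(uXu⁻¹) = tr X` and `u·1·u⁻¹ = 1` — the transporters `R(U₀(b))` of [6] (1.1) commute with
FILE 3b's `SU(N)` normalisation. [cite: Balaban1985RegularSpaces, (1.1) p.76 (bookkeeping); Balaban1985Averaging, (20) p.21] -/
theorem conjR_traceless (u : (MatA N)ˣ) (X : MatA N) : conjR u (traceless X) = traceless (conjR u X) := by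
  have htr : ((u : MatA N) * X * ((u⁻¹ : (MatA N)ˣ) : MatA N)).trace = X.trace := by
    rw [Matrix.trace_mul_cycle, Units.inv_mul, one_mul]
  simp only [traceless, conjR_apply, htr, mul_sub, sub_mul, Matrix.mul_smul, Matrix.smul_mul, mul_one, Units.mul_inv]

omit [NeZero N] in
/-- `traceless 0 = 0`. [cite: Balaban1985Averaging, (20) p.21 (bookkeeping)] -/
theorem traceless_zero' : traceless (0 : MatA N) = 0 := by
  simp [traceless]

omit [NeZero N] in
/-- [6] (1.1), second line, commutes with the traceless correction: `D^{η*}_{U₀,ν}(traceless ∘ F) = traceless ∘ D^{η*}_{U₀,ν}F` (conjugation-equivariance + `ℝ`-linearity).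
[cite: Balaban1985RegularSpaces, (1.1) p.76 (bookkeeping)] -/
theorem covDeriv_traceless (η : ℝ) (U₀ : B7Prop1Explicit.Site d → Fin d → (MatA N)ˣ) (ν : Fin d) (F : B7Prop1Explicit.Site d → MatA N) (x : B7Prop1Explicit.Site d) :
    covDeriv η U₀ ν (fun z => traceless (F z)) x = traceless (covDeriv η U₀ ν F x) := by
  simp only [covDeriv, conjR_traceless, traceless_smul_real, traceless_sub']

omit [NeZero N] in
/-- [6] (1.1), first line, commutes with the traceless correction: `D^η_{U₀,μ}(traceless ∘ F) = traceless ∘ D^η_{U₀,μ}F`. [cite: Balaban1985RegularSpaces, (1.1) p.76 (bookkeeping)] -/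
theorem covDerivFwd_traceless (η : ℝ) (U₀ : B7Prop1Explicit.Site d → Fin d → (MatA N)ˣ) (μ : Fin d) (F : B7Prop1Explicit.Site d → MatA N) (x : B7Prop1Explicit.Site d) :
    covDerivFwd η U₀ μ (fun z => traceless (F z)) x = traceless (covDerivFwd η U₀ μ F x) := by
  simp only [covDerivFwd, conjR_traceless, traceless_smul_real, traceless_sub']

omit [NeZero N] in
/-- The covariant divergence `D^{η*}_{U₀}` of a bond field ((1.38)'s inner stencil) commutes with the traceless correction. [cite: Balaban1985RegularSpaces, (1.38) p.82 (bookkeeping)] -/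
theorem covDivB_traceless (η : ℝ) (U₀ : B7Prop1Explicit.Site d → Fin d → (MatA N)ˣ) (A : B7Prop1Explicit.Site d → Fin d → MatA N) (x : B7Prop1Explicit.Site d) :
    covDivB η U₀ (fun z μ => traceless (A z μ)) x = traceless (covDivB η U₀ A x) := by
  set T : MatA N →+ MatA N := AddMonoidHom.mk' (traceless (N := N)) traceless_add with hT
  show _ = T _
  unfold covDivB
  rw [map_sum]
  refine Finset.sum_congr rfl fun μ _ => ?_
  exact covDeriv_traceless η U₀ μ (fun z => A z μ) x

omit [NeZero N] in
/-- The covariant Laplacian `Δ^η_{U₀} = D^{η*}D^η` (B9 (3.23)) commutes with the traceless correction. [cite: Balaban1985BackgroundPropagators, (3.23) p.394 (bookkeeping)] -/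
theorem covLap_traceless (η : ℝ) (U₀ : B7Prop1Explicit.Site d → Fin d → (MatA N)ˣ) (f : B7Prop1Explicit.Site d → MatA N) (x : B7Prop1Explicit.Site d) :
    covLap η U₀ (fun z => traceless (f z)) x = traceless (covLap η U₀ f x) := by
  unfold covLap
  rw [← covDivB_traceless]
  congr 1
  funext z μ
  exact covDerivFwd_traceless η U₀ μ f z

omit [NeZero N] in
/-- The Dirichlet cut-off `↾Ω₀` (zero extension, B9 (3.24)) commutes with the traceless correction (`traceless 0 = 0`). [cite: Balaban1985BackgroundPropagators, (3.24) p.394 (bookkeeping)] -/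
theorem indicator_traceless (Ω₀ : Set (B7Prop1Explicit.Site d)) (g : B7Prop1Explicit.Site d → MatA N) :
    Ω₀.indicator (fun z => traceless (g z)) = fun z => traceless (Ω₀.indicator g z) := by
  funext z
  by_cases hz : z ∈ Ω₀
  · rw [Set.indicator_of_mem hz, Set.indicator_of_mem hz]
  · rw [Set.indicator_of_notMem hz, Set.indicator_of_notMem hz, traceless_zero']

omit [NeZero N] in
/-- One transpose step `Q′(Ūʲ)ᵀ` of the linearised averaging (B9 (3.19)) commutes with the traceless correction. [cite: Balaban1985BackgroundPropagators, (3.19) p.393 (bookkeeping)] -/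
theorem qprimeT1_traceless (L : ℕ) (U₀ : B7Prop1Explicit.Site d → Fin d → (MatA N)ˣ) (j : ℕ) (ν : B7Prop1Explicit.Site d → MatA N) (x : B7Prop1Explicit.Site d) :
    qprimeT1 L U₀ j (fun z => traceless (ν z)) x = traceless (qprimeT1 L U₀ j ν x) := by
  simp only [qprimeT1, conjR_traceless, traceless_smul_real]

omit [NeZero N] in
/-- The iterated transpose `Q′_j(U₀)ᵀ` commutes with the traceless correction (induction on `j`). [cite: Balaban1985BackgroundPropagators, (3.19) p.393 (bookkeeping)] -/
theorem QprimeT_traceless (L : ℕ) (U₀ : B7Prop1Explicit.Site d → Fin d → (MatA N)ˣ) :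
    ∀ (j : ℕ) (ν : B7Prop1Explicit.Site d → MatA N) (x : B7Prop1Explicit.Site d),
      QprimeT L U₀ j (fun z => traceless (ν z)) x = traceless (QprimeT L U₀ j ν x)
  | 0, ν, x => rfl
  | j + 1, ν, x => by
    have h : qprimeT1 L U₀ j (fun z => traceless (ν z)) = fun z => traceless (qprimeT1 L U₀ j ν z) :=
      funext (qprimeT1_traceless L U₀ j ν)
    show QprimeT L U₀ j (qprimeT1 L U₀ j (fun z => traceless (ν z))) x = traceless (QprimeT L U₀ j (qprimeT1 L U₀ j ν) x)
    rw [h]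
    exact QprimeT_traceless L U₀ j _ x

omit [NeZero N] in
/-- `Q′(U₀)ᵀμ` summed over the levels `j ≤ m` against the constraint sets (B9 (3.24)) commutes with the traceless correction of the multiplier.
[cite: Balaban1985BackgroundPropagators, (3.24) p.394 (bookkeeping)] -/
theorem QT_traceless (L m : ℕ) (Λs : ℕ → Set (B7Prop1Explicit.Site d)) (U₀ : B7Prop1Explicit.Site d → Fin d → (MatA N)ˣ)
    (μ : ℕ → B7Prop1Explicit.Site d → MatA N) (x : B7Prop1Explicit.Site d) :
    QT L m Λs U₀ (fun j z => traceless (μ j z)) x = traceless (QT L m Λs U₀ μ x) := by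
  set T : MatA N →+ MatA N := AddMonoidHom.mk' (traceless (N := N)) traceless_add with hT
  show _ = T _
  unfold QT
  rw [map_sum]
  refine Finset.sum_congr rfl fun j _ => ?_
  show QprimeT L U₀ j ((Λs j).indicator fun z => traceless (μ j z)) x = traceless (QprimeT L U₀ j ((Λs j).indicator (μ j)) x)
  rw [indicator_traceless, QprimeT_traceless]

omit [NeZero N] in
/-- ★ **[6] (1.38) ∕ [15] (153) IN MULTIPLIER FORM IS STABLE UNDER THE `SU(N)` CORRECTION**: if the bond field `A` satisfies «Δ^η_{U₀}↾Ω₀(D^{η*}_{U₀}A) = Q′(U₀)ᵀμ on Ω₀» for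
some multiplier `μ`, then so does its traceless part `A − (Re tr A ∕ N)·1`, with the multiplier `traceless ∘ μ` — at ANY background `U₀` (every stencil is
conjugation-equivariant and `ℝ`-linear).  This is what lets FILE 3b's normalisation of [6] Thm 2's `U(N)`-gauge to an `SU(N)`-gauge keep print's gauge condition.
[cite: Balaban1985RegularSpaces, (1.38) p.82; Balaban1985Variational, (153) p.301] -/
theorem isLandau138_traceless {L m : ℕ} {η : ℝ} {Ω₀ : Set (B7Prop1Explicit.Site d)} {Λs : ℕ → Set (B7Prop1Explicit.Site d)}
    {U₀ : B7Prop1Explicit.Site d → Fin d → (MatA N)ˣ} {A : B7Prop1Explicit.Site d → Fin d → MatA N} (h : IsLandau138 L m η Ω₀ Λs U₀ A) :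
    IsLandau138 L m η Ω₀ Λs U₀ (fun z μ => traceless (A z μ)) := by
  obtain ⟨μ, hμ⟩ := h
  refine ⟨fun j z => traceless (μ j z), fun x hx => ?_⟩
  have hdiv : covDivB η U₀ (fun z κ => traceless (A z κ)) = fun z => traceless (covDivB η U₀ A z) :=
    funext (covDivB_traceless η U₀ A)
  rw [hdiv, indicator_traceless, covLap_traceless, QT_traceless, hμ x hx]

end Traceless

/-! ## §1b  The covariant Laplacian `Δ^η` ([6] (1.136)₄, B9 (3.23)) at the trivial background: closed form, size, locality -/

section LapOne

variable {𝔸 : Type*} [NormedRing 𝔸] [NormedAlgebra ℂ 𝔸]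

/-- [6] (1.1), first line, AT THE TRIVIAL BACKGROUND: `(D^η_{1,μ}F)(x) = η⁻¹(F(x + e_μ) − F(x))`. [cite: Balaban1985RegularSpaces, (1.1) p.76] -/
theorem covDerivFwd_one_apply (η : ℝ) (μ : Fin d) (F : B7Prop1Explicit.Site d → 𝔸) (x : B7Prop1Explicit.Site d) :
    covDerivFwd η (1 : B7Prop1Explicit.Site d → Fin d → 𝔸ˣ) μ F x = η⁻¹ • (F (x + e μ) - F x) := by
  simp only [covDerivFwd, Pi.one_apply, conjR_apply, Units.val_one, inv_one, one_mul, mul_one]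

/-- B9 (3.23) AT THE TRIVIAL BACKGROUND: `(Δ^ηF)(x) = Σ_ν η⁻¹[η⁻¹(F(x) − F(x − e_ν)) − η⁻¹(F(x + e_ν) − F(x))]` (lit-balaban's `covLap η 1 = D^{η*}D^η`, the positive
second-difference operator). [cite: Balaban1985BackgroundPropagators, (3.23) p.394; Balaban1985RegularSpaces, (1.1) p.76] -/
theorem covLap_one_apply (η : ℝ) (F : B7Prop1Explicit.Site d → 𝔸) (x : B7Prop1Explicit.Site d) :
    covLap η (1 : B7Prop1Explicit.Site d → Fin d → 𝔸ˣ) F x =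
      ∑ ν : Fin d, η⁻¹ • (η⁻¹ • (F x - F (x - e ν)) - η⁻¹ • (F (x + e ν) - F x)) := by
  unfold covLap covDivB
  refine Finset.sum_congr rfl fun ν _ => ?_
  rw [covDeriv_one_apply]
  dsimp only
  rw [covDerivFwd_one_apply, covDerivFwd_one_apply, sub_add_cancel]

/-- The Laplacian of a bounded function at the trivial background: `‖F‖ ≤ m` everywhere ⇒ `‖(Δ^ηF)(x)‖ ≤ d·η⁻¹·η⁻¹·4m` (crude; the boundedness side condition of the
p. 86 norm). [cite: Balaban1985RegularSpaces, p.86 (definition after (1.55)); Balaban1985BackgroundPropagators, (3.23) p.394 (bookkeeping)] -/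
theorem norm_covLap_one_le {η m : ℝ} (hη : 0 < η) {F : B7Prop1Explicit.Site d → 𝔸} (hF : ∀ y, ‖F y‖ ≤ m) (x : B7Prop1Explicit.Site d) :
    ‖covLap η (1 : B7Prop1Explicit.Site d → Fin d → 𝔸ˣ) F x‖ ≤ d * (η⁻¹ * (η⁻¹ * (4 * m))) := by
  rw [covLap_one_apply]
  have hterm : ∀ ν : Fin d, ‖η⁻¹ • (η⁻¹ • (F x - F (x - e ν)) - η⁻¹ • (F (x + e ν) - F x))‖ ≤ η⁻¹ * (η⁻¹ * (4 * m)) := by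
    intro ν
    rw [← smul_sub, norm_smul, norm_smul, Real.norm_eq_abs, abs_of_pos (inv_pos.2 hη)]
    refine mul_le_mul_of_nonneg_left (mul_le_mul_of_nonneg_left ?_ (inv_nonneg.2 hη.le)) (inv_nonneg.2 hη.le)
    calc ‖F x - F (x - e ν) - (F (x + e ν) - F x)‖ ≤ (‖F x‖ + ‖F (x - e ν)‖) + (‖F (x + e ν)‖ + ‖F x‖) :=
          (norm_sub_le _ _).trans (add_le_add (norm_sub_le _ _) (norm_sub_le _ _))
      _ ≤ (m + m) + (m + m) := by gcongr <;> exact hF _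
      _ = 4 * m := by ring
  calc ‖∑ ν : Fin d, η⁻¹ • (η⁻¹ • (F x - F (x - e ν)) - η⁻¹ • (F (x + e ν) - F x))‖
      ≤ ∑ ν : Fin d, ‖η⁻¹ • (η⁻¹ • (F x - F (x - e ν)) - η⁻¹ • (F (x + e ν) - F x))‖ := norm_sum_le _ _
    _ ≤ ∑ _ν : Fin d, η⁻¹ * (η⁻¹ * (4 * m)) := Finset.sum_le_sum fun ν _ => hterm ν
    _ = d * (η⁻¹ * (η⁻¹ * (4 * m))) := by rw [Finset.sum_const, Finset.card_univ, Fintype.card_fin, nsmul_eq_mul]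

/-- LOCALITY of `Δ^η` at the trivial background: `(Δ^ηF)(x)` reads `F` only at `x`, `x ± e_ν`. [cite: Balaban1985BackgroundPropagators, (3.23) p.394 (bookkeeping)] -/
theorem covLap_one_congr (η : ℝ) {F F' : B7Prop1Explicit.Site d → 𝔸} {x : B7Prop1Explicit.Site d} (h0 : F x = F' x)
    (hν : ∀ ν, F (x + e ν) = F' (x + e ν) ∧ F (x - e ν) = F' (x - e ν)) :
    covLap η (1 : B7Prop1Explicit.Site d → Fin d → 𝔸ˣ) F x = covLap η (1 : B7Prop1Explicit.Site d → Fin d → 𝔸ˣ) F' x := by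
  rw [covLap_one_apply, covLap_one_apply]
  refine Finset.sum_congr rfl fun ν _ => ?_
  rw [h0, (hν ν).1, (hν ν).2]

end LapOne

/-! ## §1c  The (1.136)₄ member of `GaugedBoundB8` read pointwise inside `□` (the p. 86 supremum; masked and unmasked exponent) -/

section LapLetters

variable {L K : ℕ} {Ω : ℕ → Set (B7Prop1Explicit.Site d)} (c : CubeB8 d L K Ω)
variable {𝔸 : Type*} [CStarAlgebra 𝔸]

/-- **THE (1.136)₄ FAMILY IS BOUNDED** (`B8ScaledSupNorm.Bdd`): the weights `(Lʲη)³`, `j ≤ k`, are at most `(Lᵏη)³` and `Δ^η` of each component of the masked exponent (bounded by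
`rη⁻¹` everywhere, FILE 28a `norm_mlogCfg_le_of_sides`) is bounded by `d·η⁻¹·η⁻¹·4·rη⁻¹` — the side condition under which the p. 86 supremum `|·|_(−3)` reads pointwise.
[cite: Balaban1985RegularSpaces, Prop. 6 (1.136) p.99, p.86 (the scaled sup norm)] -/
theorem bdd_lapFamily_of_sides (hL : 1 ≤ L) {η r : ℝ} (hη : 0 < η) (hr : 0 ≤ r) (U₁ : B7Prop1Explicit.Site d → Fin d → 𝔸ˣ)
    (h136 : ∀ j, j ≤ c.k → ∀ b ∈ {b : B7Prop1Explicit.Site d × Fin d | SideTouches (c.sq j) b.1 b.2}, ‖logCfg η U₁ b.1 b.2‖ ≤ r * ((L : ℝ) ^ j * η)⁻¹) :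
    Bdd L c.k η (-(3 : ℝ)) (fun j (b : B7Prop1Explicit.Site d × Fin d) => BondTouches (c.sq j) b.1 b.2)
      (fun b => covLap η (1 : B7Prop1Explicit.Site d → Fin d → 𝔸ˣ) (fun z => mlogCfg c.k η c.sq U₁ z b.2) b.1) := by
  refine ⟨((L : ℝ) ^ c.k * η) ^ (3 : ℝ) * (d * (η⁻¹ * (η⁻¹ * (4 * (r * η⁻¹))))), fun j hj b _ => ?_⟩
  have hscale : 0 < (L : ℝ) ^ j * η := B8ScaledSupNorm.scale_pos hL hη j
  have hw : B8ScaledSupNorm.weight L η (-(3 : ℝ)) j ≤ ((L : ℝ) ^ c.k * η) ^ (3 : ℝ) := by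
    rw [B8ScaledSupNorm.weight, neg_neg]
    exact Real.rpow_le_rpow hscale.le (mul_le_mul_of_nonneg_right (pow_le_pow_right₀ (by exact_mod_cast hL) hj) hη.le) (by norm_num)
  have hm : ∀ y, ‖mlogCfg c.k η c.sq U₁ y b.2‖ ≤ r * η⁻¹ := fun y => norm_mlogCfg_le_of_sides c hL hη hr U₁ h136 y b.2
  have hF := norm_covLap_one_le hη hm b.1
  exact mul_le_mul hw hF (norm_nonneg _) (by positivity)

/-- **`|Δ^ηA|_(−3) ≤ r` READ POINTWISE INSIDE `□`, masked exponent**: for `x ∈ □`, `‖(Δ^ηÃ_μ)(x)‖ ≤ r·((Lᵏη)³)⁻¹` (`Ã = mlogCfg …`, the (1.136)₄ member of `Node00.GaugedBoundB8`,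
its tenth conjunct). [cite: Balaban1985RegularSpaces, Prop. 6 (1.136) p.99 («(Lʲη)³|Δ^η A| ≤ …»), p.86] -/
theorem norm_lap_mlogCfg_le (hL : 1 ≤ L) {η r : ℝ} (hη : 0 < η) (hr : 0 ≤ r) (U₁ : B7Prop1Explicit.Site d → Fin d → 𝔸ˣ)
    (h136 : ∀ j, j ≤ c.k → ∀ b ∈ {b : B7Prop1Explicit.Site d × Fin d | SideTouches (c.sq j) b.1 b.2}, ‖logCfg η U₁ b.1 b.2‖ ≤ r * ((L : ℝ) ^ j * η)⁻¹)
    (hlap : bondNorm L c.k η (-(3 : ℝ)) c.sq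
        (fun x μ => covLap η (1 : B7Prop1Explicit.Site d → Fin d → 𝔸ˣ) (fun z => mlogCfg c.k η c.sq U₁ z μ) x) ≤ r)
    {x : B7Prop1Explicit.Site d} (hx : x ∈ box L c.a c.M c.k) (μ : Fin d) :
    ‖covLap η (1 : B7Prop1Explicit.Site d → Fin d → 𝔸ˣ) (fun z => mlogCfg c.k η c.sq U₁ z μ) x‖ ≤ r * (((L : ℝ) ^ c.k * η) ^ 3)⁻¹ := by
  have h := B8ScaledSupNorm.norm_le_of_msup_le (F := fun b : B7Prop1Explicit.Site d × Fin d =>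
      covLap η (1 : B7Prop1Explicit.Site d → Fin d → 𝔸ˣ) (fun z => mlogCfg c.k η c.sq U₁ z b.2) b.1)
    (mem := fun j (b : B7Prop1Explicit.Site d × Fin d) => BondTouches (c.sq j) b.1 b.2)
    hL hη (bdd_lapFamily_of_sides c hL hη hr U₁ h136) hlap le_rfl (i := (x, μ)) (bondTouches_sq_top_of_mem_box c hx μ)
  have hscale : 0 < (L : ℝ) ^ c.k * η := B8ScaledSupNorm.scale_pos hL hη c.k
  have hrpow : ((L : ℝ) ^ c.k * η) ^ (-(3 : ℝ)) = (((L : ℝ) ^ c.k * η) ^ 3)⁻¹ := by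
    rw [Real.rpow_neg hscale.le, show (3 : ℝ) = ((3 : ℕ) : ℝ) by norm_num, Real.rpow_natCast]
  rw [hrpow] at h
  exact h

/-- **`|Δ^ηA|_(−3) ≤ r` READ POINTWISE INSIDE `□`, unmasked exponent `A = (1∕iη) log U₁`**: if `x`, `x ± e_ν` lie in `□`, the masked exponent is the logarithm on every bond read
(FILE 28a `mlogCfg_eq_logCfg_of_mem_box`) and `‖(Δ^ηA_μ)(x)‖ ≤ r·((Lᵏη)³)⁻¹`. [cite: Balaban1985RegularSpaces, Prop. 6 (1.135)–(1.136) p.99] -/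
theorem norm_lap_logCfg_le (hd : 2 ≤ d) (hL : 1 ≤ L) {η r : ℝ} (hη : 0 < η) (hr : 0 ≤ r) (U₁ : B7Prop1Explicit.Site d → Fin d → 𝔸ˣ)
    (h136 : ∀ j, j ≤ c.k → ∀ b ∈ {b : B7Prop1Explicit.Site d × Fin d | SideTouches (c.sq j) b.1 b.2}, ‖logCfg η U₁ b.1 b.2‖ ≤ r * ((L : ℝ) ^ j * η)⁻¹)
    (hlap : bondNorm L c.k η (-(3 : ℝ)) c.sq
        (fun x μ => covLap η (1 : B7Prop1Explicit.Site d → Fin d → 𝔸ˣ) (fun z => mlogCfg c.k η c.sq U₁ z μ) x) ≤ r)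
    {x : B7Prop1Explicit.Site d} (hx : x ∈ box L c.a c.M c.k) (hν : ∀ ν, x + e ν ∈ box L c.a c.M c.k ∧ x - e ν ∈ box L c.a c.M c.k) (μ : Fin d) :
    ‖covLap η (1 : B7Prop1Explicit.Site d → Fin d → 𝔸ˣ) (fun z => logCfg η U₁ z μ) x‖ ≤ r * (((L : ℝ) ^ c.k * η) ^ 3)⁻¹ := by
  have heq := covLap_one_congr η (F := fun z => mlogCfg c.k η c.sq U₁ z μ) (F' := fun z => logCfg η U₁ z μ) (x := x)
    (mlogCfg_eq_logCfg_of_mem_box c hd η U₁ hx μ)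
    (fun ν => ⟨mlogCfg_eq_logCfg_of_mem_box c hd η U₁ (hν ν).1 μ, mlogCfg_eq_logCfg_of_mem_box c hd η U₁ (hν ν).2 μ⟩)
  rw [← heq]
  exact norm_lap_mlogCfg_le c hL hη hr U₁ h136 hlap hx μ

end LapLetters

/-! ## §2  ★★ 34a's `SU(N)` gauge on the box WITH the Laplacian member (1.136)₄ AND the gauge condition (1.38) ∕ (153) for the same potential -/

section Assembly

variable {L K : ℕ} {Ω : ℕ → Set (B7Prop1Explicit.Site d)}

/-- ★★ **[6] PROPOSITION 6's CONCLUSION READ AS AN `SU(N)` GAUGE ON `□`, WITH [15] (153) ∕ [6] (1.38) KEPT** — 34a's ★★ `exists_suGauge_letters10_of_gaugedBoundB8` (same hypotheses BYTE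
FOR BYTE: `V` `SU(N)`-valued on `ℤᵈ`, a cube datum `c`, `L ≥ 2`, `d ≥ 2`, `η > 0`, `r ≥ 0`, `Node00.GaugedBoundB8 L η V c r`, the `2π`-window) with a FIFTH conclusion for the
SAME potential `Ã` (the traceless part of (1.136)'s `A = (iη)⁻¹ log U₁`, `U₁ = U₀″^{u⁻¹}`): `Ã` satisfies [6] (1.38) «R D^{η*}A = 0» at the trivial background, for the Dirichlet
domain `□₀ = c.sq 0` (the largest cube of the tower (144)) and the constraint tower `{Λ′_j}_{j ≤ k} = c.lamS`, in N05's multiplier form `B8Eq138LandauZd.IsLandau138` — [15] (153) «R ∂^{η*}A = 0, where the operator R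
is defined for the sequence {Ω″_j}» ∕ [6] (1.138) «the operator R is determined by {□_j}», read at the member.  Source: the fourth conjunct `IsLandau138W … 1 (c.fixed V u)` of
`GaugedBoundB8` (N05's export, never proved here) and §1's `isLandau138_traceless`.
[cite: Balaban1985Variational, (152)–(153) p.301; Balaban1985RegularSpaces, Prop. 6 (1.135)–(1.138) p.99, Thm 2 (1.36)–(1.38) p.82] -/
theorem exists_suGauge_letters152_153_of_gaugedBoundB8 (hd : 2 ≤ d) (hL : 2 ≤ L) (c : CubeB8 d L K Ω)
    (V : B7Prop1Explicit.Site d → Fin d → (MatA N)ˣ) (hV : ∀ x μ, V x μ ∈ specialUnitaryUnits (Fin N)) {η r : ℝ} (hη : 0 < η) (hr : 0 ≤ r)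
    (hG : letI : CStarAlgebra (MatA N) := {}; GaugedBoundB8 L η V c r)
    (hsmall : (2 * boxWidth (bLo L c.a c.k 0) (bHi L c.a c.M c.k 0) + 1) * (η * N * (r * ((L : ℝ) ^ c.k * η)⁻¹)) < 2 * Real.pi) :
    ∃ s : B7Prop1Explicit.Site d → Matrix.specialUnitaryGroup (Fin N) ℂ, ∃ A' : B7Prop1Explicit.Site d → Fin d → MatA N,
      (∀ x μ, x ∈ box L c.a c.M c.k → x + e μ ∈ box L c.a c.M c.k →
          B7Prop1Explicit.gaugeAct (fun y => ιSU N (s y)) V x μ = cfgExp η A' x μ) ∧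
      (∀ x μ, x ∈ box L c.a c.M c.k → x + e μ ∈ box L c.a c.M c.k → ‖A' x μ‖ ≤ 2 * (r * ((L : ℝ) ^ c.k * η)⁻¹)) ∧
      (∀ x μ ν, x ∈ box L c.a c.M c.k → x + e μ ∈ box L c.a c.M c.k → x + e ν ∈ box L c.a c.M c.k →
          ‖A' (x + e μ) ν - A' x ν‖ ≤ 2 * (η * r * (((L : ℝ) ^ c.k * η) ^ 2)⁻¹)) ∧
      (∀ x μ, x ∈ box L c.a c.M c.k → x + e μ ∈ box L c.a c.M c.k →
          (∀ ν, x + e ν ∈ box L c.a c.M c.k ∧ x - e ν ∈ box L c.a c.M c.k ∧ x - e ν + e μ ∈ box L c.a c.M c.k) →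
          ‖pdiv η (1 : B7Prop1Explicit.Site d → Fin d → (MatA N)ˣ) (plaqCovDeriv η 1 A') μ x‖ ≤ 2 * (r * (((L : ℝ) ^ c.k * η) ^ 3)⁻¹)) ∧
      (∀ x μ, x ∈ box L c.a c.M c.k → x + e μ ∈ box L c.a c.M c.k → (∀ ν, x + e ν ∈ box L c.a c.M c.k ∧ x - e ν ∈ box L c.a c.M c.k) →
          ‖covLap η (1 : B7Prop1Explicit.Site d → Fin d → (MatA N)ˣ) (fun z => A' z μ) x‖ ≤ 2 * (r * (((L : ℝ) ^ c.k * η) ^ 3)⁻¹)) ∧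
      IsLandau138 L c.k η (c.sq 0) c.lamS (1 : B7Prop1Explicit.Site d → Fin d → (MatA N)ˣ) A' := by
  letI : CStarAlgebra (MatA N) := {}
  have hL1 : 1 ≤ L := le_trans (by norm_num) hL
  obtain ⟨u, hu, -, -, h138, h162, hw, h135, h136₂, h136₃, h136₄, -⟩ := hG
  set w : B7Prop1Explicit.Site d → (MatA N)ˣ := (c.vfix V)⁻¹ * u with hwdef
  set U₁ : B7Prop1Explicit.Site d → Fin d → (MatA N)ˣ := c.fixed V u with hU₁
  have h138' : IsLandau138 L c.k η (c.sq 0) c.lamS (1 : B7Prop1Explicit.Site d → Fin d → (MatA N)ˣ) (logCfg η U₁) := h138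
  have hg : ∀ x, InBox (bLo L c.a c.k 0) (bHi L c.a c.M c.k 0) x → w⁻¹ x ∈ unitaryUnits (MatA N) := fun x _ => by
    rw [Pi.inv_apply]; exact (unitaryUnits (MatA N)).inv_mem (hw x)
  have hboxT : box L c.a c.M c.k ⊆ tcube L c.a c.M c.ρ c.k := box_subset_tcube_of_le L c.a le_rfl c.ρ c.k
  have h136' : ∀ j, j ≤ c.k → ∀ b ∈ {b : B7Prop1Explicit.Site d × Fin d | SideTouches (c.sq j) b.1 b.2},
      ‖logCfg η U₁ b.1 b.2‖ ≤ r * ((L : ℝ) ^ j * η)⁻¹ := fun j hj b hb => (h162 j hj b hb).2.2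
  have hgauge : ∀ x μ, InBox (bLo L c.a c.k 0) (bHi L c.a c.M c.k 0) x → InBox (bLo L c.a c.k 0) (bHi L c.a c.M c.k 0) (x + e μ) →
      B7Prop1Explicit.gaugeAct w⁻¹ V x μ = cfgExp η (logCfg η U₁) x μ := by
    intro x μ hx hx'
    rw [h135 x μ (hboxT hx) (hboxT hx')]
    exact (h162 c.k le_rfl (x, μ) (sideTouches_sq_top_of_mem_box c hd hx μ)).1
  have hsa : ∀ x μ, InBox (bLo L c.a c.k 0) (bHi L c.a c.M c.k 0) x → InBox (bLo L c.a c.k 0) (bHi L c.a c.M c.k 0) (x + e μ) →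
      IsSelfAdjoint (logCfg η U₁ x μ) := fun x μ hx _ => (h162 c.k le_rfl (x, μ) (sideTouches_sq_top_of_mem_box c hd hx μ)).2.1
  have hA : ∀ x μ, InBox (bLo L c.a c.k 0) (bHi L c.a c.M c.k 0) x → InBox (bLo L c.a c.k 0) (bHi L c.a c.M c.k 0) (x + e μ) →
      ‖logCfg η U₁ x μ‖ ≤ r * ((L : ℝ) ^ c.k * η)⁻¹ := fun x μ hx _ => h136' c.k le_rfl (x, μ) (sideTouches_sq_top_of_mem_box c hd hx μ)
  have hVdet : ∀ x μ, InBox (bLo L c.a c.k 0) (bHi L c.a c.M c.k 0) x → InBox (bLo L c.a c.k 0) (bHi L c.a c.M c.k 0) (x + e μ) →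
      ((V x μ : (MatA N)ˣ) : MatA N).det = 1 := fun x μ _ _ => (Matrix.mem_specialUnitaryGroup_iff.1 (hV x μ)).2
  have hr₀ : 0 ≤ r * ((L : ℝ) ^ c.k * η)⁻¹ := mul_nonneg hr (inv_nonneg.2 (B8ScaledSupNorm.scale_pos hL1 hη c.k).le)
  obtain ⟨s, hs⟩ := exists_suGauge_of_unitaryGauge (bLo L c.a c.k 0) (bHi L c.a c.M c.k 0) hη.le V w⁻¹ (logCfg η U₁) hr₀ hVdet hg hgauge hsa hA hsmall
  refine ⟨s, fun y ν => traceless (logCfg η U₁ y ν), fun x μ hx hx' => hs x μ hx hx', fun x μ hx hx' => ?_, fun x μ ν hx hx' _ => ?_,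
    fun x μ hx hx' hν => ?_, fun x μ hx _ hν => ?_, isLandau138_traceless h138'⟩
  · exact (norm_traceless_le _).trans (mul_le_mul_of_nonneg_left (hA x μ hx hx') (by norm_num))
  · exact (norm_traceless_sub_le _ _).trans
      (mul_le_mul_of_nonneg_left (norm_sub_le_of_msup_grad c hd hL1 hη hr U₁ h136' h136₂ hx hx') (by norm_num))
  · rw [pdiv_plaqCovDeriv_one_traceless]
    exact (norm_traceless_le _).trans (mul_le_mul_of_nonneg_left (norm_codiff_logCfg_le c hd hL1 hη hr U₁ h136' h136₃ hx hx' hν) (by norm_num))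
  · rw [covLap_traceless]
    exact (norm_traceless_le _).trans (mul_le_mul_of_nonneg_left (norm_lap_logCfg_le c hd hL1 hη hr U₁ h136' h136₄ hx hν μ) (by norm_num))

end Assembly

/-! ## §3  ★★ 34b's push-down to one grid cube of the torus WITH the (153)-gauge of the lifted potential -/

section PushDown

variable {P : Params}

omit [NeZero N] in
/-- **THE LAPLACIAN MEMBER UNDER THE PUSH-DOWN**: for a torus potential `A` that is the `cover`-push-forward of `A′` on the lifted cube, at `π x` with `x`, `x ± e_ν` in the
lifted cube, `Σ_ν η⁻¹[(∇^η_νA_μ)((π x) − e_ν) − (∇^η_νA_μ)(π x)]` (r11's `grad` letters on the torus; [6] (1.136)₄'s `Δ^ηA` at background `1` up to the sign convention of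
lit-balaban's `covLap = D^{η*}D^η`) IS lit-balaban's `covLap η 1 (A′ · μ) x` — the analogue of 34b's `codiffCurlA_cover_eq_pdiv`. [cite: Balaban1985BackgroundPropagators, (3.23) p.394; Balaban1985RegularSpaces, (1.136) p.99 (bookkeeping under the cover)] -/
theorem lap_cover_eq_covLap (η : ℝ) {S : ℕ} {a : Pt P.d} {A : PBond P 0 → MatA N} {A' : B7Prop1Explicit.Site P.d → Fin P.d → MatA N}
    (hA : ∀ z, z ∈ cubeExt S a 0 → ∀ κ, A ⟨cover P z, κ⟩ = A' z κ) {x : B7Prop1Explicit.Site P.d}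
    (hx : x ∈ cubeExt S a 0) (hν : ∀ ν, x + e ν ∈ cubeExt S a 0 ∧ x - e ν ∈ cubeExt S a 0) (μ : Fin P.d) :
    ∑ ν : Fin P.d, ((η : ℝ) : ℂ)⁻¹ • (grad η ν (fun y => A ⟨y, μ⟩) ((cover P x).unshift ν) - grad η ν (fun y => A ⟨y, μ⟩) (cover P x)) =
      covLap η (1 : B7Prop1Explicit.Site P.d → Fin P.d → (MatA N)ˣ) (fun z => A' z μ) x := by
  rw [covLap_one_apply]
  refine Finset.sum_congr rfl fun ν _ => ?_
  obtain ⟨h1, h2⟩ := hν ν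
  rw [← cover_sub_e, grad, grad, ← cover_add_e, ← cover_add_e, sub_add_cancel]
  simp only [hA _ hx, hA _ h1, hA _ h2, ← Complex.ofReal_inv, Complex.coe_smul]

/-- ★★ **[6] PROPOSITION 6 AT NODE 00's `ℤᵈ` MEMBER ⇒ THE LOCAL GAUGE OF [15] (152) ON ONE GRID CUBE OF THE TORUS, WITH THE GAUGE CONDITION (153) OF ITS LIFT** — 34b's ★★★
`exists_localGauge10_cube_of_prop6` (same hypotheses BYTE FOR BYTE: `d ≥ 2`; the Proposition-6 slot `B8.Prop6Printed d L B₁ c₁ (zdCub (M_N ℂ) L ·)`; the class (1.7)∕(1.9)-Top of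
`U`; the scale `1 ≤ n ≤ kT + 1`; the non-wrapping grid cube `□ = cubeEnl P (LⁿM) a 0` with its Prop.-6 collar in the scale-`(n−1)` level set; print's «7dL²M′α₀ ≤ c₁» and the
`2π`-window; the same four letter clauses on `□`) with a FIFTH conjunct: the cube potential `A` is the push-forward along the cover `π` of a `ℤᵈ` potential `A′` — `A ⟨π x, μ⟩ =
A′ x μ` for `x` in the lifted cube `cubeExt (LⁿM) a 0` — which satisfies [6] (1.38) ∕ [15] (153) «R ∂^{η*}A′ = 0» at the trivial background and unit `η_n`, for the Dirichlet
domain `□₀ = c.sq 0` (the largest cube of the tower (144)) and the constraint tower `{Λ′_j} = c.lamS` of the Prop.-6 cube datum `c = propCube P n hn M a` of the grid cube (N05's multiplier form `IsLandau138`).  The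
cube `□₀` strictly contains the lifted grid cube, so this is a statement about the LIFT, of which the torus potential is the restriction; no torus-native operator `R`
is claimed.  The same `u`, `A` as 34b's construction. [cite: Balaban1985Variational, (144)–(153) pp.300–301; Balaban1985RegularSpaces, Prop. 6 (1.135)–(1.138) p.99, (1.38) p.82] -/
theorem exists_localGauge152_153_cube_of_prop6 (hd : 2 ≤ P.d) {B₁ c₁ : ℝ} (hB₁ : 0 ≤ B₁)
    (hP6 : letI : CStarAlgebra (MatA N) := {}; B8.Prop6Printed P.d (P.L : ℝ) B₁ c₁ (fun i : ZdIdx P.d P.L => zdCub (MatA N) P.L i))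
    {Ω : ℕ → Set (Site P 0)} {Ω₀ : Set (Site P 0)} {kT : ℕ} {ε : ℕ → ℝ} (U : GaugeField P 0 (SU N))
    (hP : ∀ m, m ≤ kT → PlaqSmallOn (Sect2.omegaPlaqsTop Ω Ω₀ m) (ε m * P.eta m ^ 2) U)
    (hD : ∀ m, m ≤ kT → Sect2.CoDivSmallOn (Sect2.omegaBondsTop Ω Ω₀ m) (ε m * P.eta m ^ 3) U)
    {n : ℕ} (hn : 1 ≤ n) (hnk : n ≤ kT + 1) (hε : 0 < ε (n - 1)) {M : ℕ} (a : Pt P.d)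
    (hSN : ((side P.L M n : ℕ) : ℤ) < P.sitesPerDir 0)
    (hcollar : cover P '' (cubeIdx' P n hn M a).Ω 0 ⊆ (if n - 1 = 0 then Ω₀ else Ω (n - 1)))
    (hc₁ : 7 * P.d * (P.L : ℝ) ^ 2 * (propCube P n hn M a).M * ((P.L : ℝ) ^ 3 * ε (n - 1)) ≤ c₁)
    (h2π : (2 * boxWidth (bLo P.L (propCube P n hn M a).a (propCube P n hn M a).k 0)
        (bHi P.L (propCube P n hn M a).a (propCube P n hn M a).M (propCube P n hn M a).k 0) + 1) *
        (P.eta n * N * (7 * P.d * (P.L : ℝ) ^ 2 * B₁ * (propCube P n hn M a).M * ((P.L : ℝ) ^ 3 * ε (n - 1)) *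
          ((P.L : ℝ) ^ (propCube P n hn M a).k * P.eta n)⁻¹)) < 2 * Real.pi) :
    ∃ u : GaugeTransf P 0 (SU N), ∃ A : PBond P 0 → MatA N,
      (∀ b ∈ (Sect2.regionOfSet P (cubeEnl P (side P.L M n) a 0)).bonds,
          gaugeU (fun x => ιSU N (u x)) (fun b' => ιSU N (U b')) b = expI (P.eta n) (A b)) ∧
      (∀ b ∈ (Sect2.regionOfSet P (cubeEnl P (side P.L M n) a 0)).bonds,
          ‖A b‖ ≤ 2 * (7 * P.d * (P.L : ℝ) ^ 2 * B₁ * (propCube P n hn M a).M * ((P.L : ℝ) ^ 3 * ε (n - 1)))) ∧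
      (∀ q ∈ (Sect2.regionOfSet P (cubeEnl P (side P.L M n) a 0)).dpairs,
          ‖grad (P.eta n) q.2.1 (fun y => A ⟨y, q.2.2⟩) q.1‖ ≤ 2 * (7 * P.d * (P.L : ℝ) ^ 2 * B₁ * (propCube P n hn M a).M * ((P.L : ℝ) ^ 3 * ε (n - 1)))) ∧
      (∀ b ∈ Sect2.bondsDeep (cubeEnl P (side P.L M n) a 0),
          ‖Sect2.codiffCurlA (P.eta n) A b.src b.dir‖ ≤ 2 * (7 * P.d * (P.L : ℝ) ^ 2 * B₁ * (propCube P n hn M a).M * ((P.L : ℝ) ^ 3 * ε (n - 1)))) ∧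
      (∀ b ∈ Sect2.bondsDeep (cubeEnl P (side P.L M n) a 0),
          ‖∑ ν : Fin P.d, ((P.eta n : ℝ) : ℂ)⁻¹ • (grad (P.eta n) ν (fun y => A ⟨y, b.dir⟩) (b.src.unshift ν) - grad (P.eta n) ν (fun y => A ⟨y, b.dir⟩) b.src)‖ ≤
            2 * (7 * P.d * (P.L : ℝ) ^ 2 * B₁ * (propCube P n hn M a).M * ((P.L : ℝ) ^ 3 * ε (n - 1)))) ∧
      ∃ A' : B7Prop1Explicit.Site P.d → Fin P.d → MatA N,
        (∀ x, x ∈ cubeExt (side P.L M n) a 0 → ∀ μ, A ⟨cover P x, μ⟩ = A' x μ) ∧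
        IsLandau138 P.L (propCube P n hn M a).k (P.eta n) ((propCube P n hn M a).sq 0) (propCube P n hn M a).lamS
          (1 : B7Prop1Explicit.Site P.d → Fin P.d → (MatA N)ˣ) A' := by
  classical
  letI : CStarAlgebra (MatA N) := {}
  have hL : 2 ≤ P.L := P.hL.2
  have hL1 : 1 ≤ P.L := P.L_pos
  have hηpos : 0 < P.eta n := B3GkZeroTorusRescaled.eta_pos P n
  set i : ZdIdx P.d P.L := cubeIdx' P n hn M a with hi
  set c := propCube P n hn M a with hc
  set V := zdLift N U with hV
  set α : ℝ := (P.L : ℝ) ^ 3 * ε (n - 1) with hα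
  have hαpos : 0 < α := by positivity
  have hInAk : InAk P.L i.k i.η α i.Ω V :=
    inAk_zdLift_of_top U hP hD hηpos (lvl := fun _ => n - 1) (fun j _ => by omega) (fun j _ => hcollar)
      (fun j hj => (tol_of_level_pred P hn hε.le hj).1) (fun j hj => (tol_of_level_pred P hn hε.le hj).2)
  have hVU : ∀ x κ, V x κ ∈ unitaryUnits (MatA N) := fun x κ => zdLift_mem_unitaryUnits U x κ
  have hG : GaugedBoundB8 P.L i.η V c (7 * P.d * (P.L : ℝ) ^ 2 * B₁ * c.M * α) :=
    (prop6Printed_zdCub_iff (fun i : ZdIdx P.d P.L => i) B₁ c₁).1 hP6 i α hαpos ⟨V, hVU⟩ hInAk c hc₁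
  set r : ℝ := 7 * P.d * (P.L : ℝ) ^ 2 * B₁ * c.M * α with hr
  have hr0 : 0 ≤ r := by positivity
  have hη' : i.η = P.eta n := rfl
  rw [hη'] at hG
  obtain ⟨s, A', h1, h2, h3, h4, h4', h5⟩ := exists_suGauge_letters152_153_of_gaugedBoundB8 hd hL c V (zdLift_mem_specialUnitaryUnits U) hηpos hr0 hG h2π
  have hscale : (P.L : ℝ) ^ c.k * P.eta n = 1 := B12Eq115BackgroundPair.pow_mul_eta P n
  simp only [hscale, inv_one, mul_one, one_pow] at h2 h3 h4 h4'
  have hbox : cubeExt (side P.L M n) a 0 ⊆ box P.L c.a c.M c.k := cubeExt_subset_box_propCube P n hn M a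
  -- push-down through the (injective) cover, as in 34b
  let u : GaugeTransf P 0 (SU N) := fun y =>
    if h : ∃ x, x ∈ cubeExt (side P.L M n) a 0 ∧ cover P x = y then s (Classical.choose h) else 1
  let A : PBond P 0 → MatA N := fun b =>
    if h : ∃ x, x ∈ cubeExt (side P.L M n) a 0 ∧ cover P x = b.src then A' (Classical.choose h) b.dir else 0
  have hu : ∀ x, x ∈ cubeExt (side P.L M n) a 0 → u (cover P x) = s x := by
    intro x hx
    have hex : ∃ x', x' ∈ cubeExt (side P.L M n) a 0 ∧ cover P x' = cover P x := ⟨x, hx, rfl⟩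
    simp only [u, dif_pos hex]
    rw [eq_of_cover_eq_of_mem_cubeExt hSN.le (Classical.choose_spec hex).1 hx (Classical.choose_spec hex).2]
  have hA : ∀ x, x ∈ cubeExt (side P.L M n) a 0 → ∀ μ, A ⟨cover P x, μ⟩ = A' x μ := by
    intro x hx μ
    have hex : ∃ x', x' ∈ cubeExt (side P.L M n) a 0 ∧ cover P x' = cover P x := ⟨x, hx, rfl⟩
    simp only [A, dif_pos hex]
    rw [eq_of_cover_eq_of_mem_cubeExt hSN.le (Classical.choose_spec hex).1 hx (Classical.choose_spec hex).2]
  have hlift : ∀ y, y ∈ cubeEnl P (side P.L M n) a 0 → ∃ x, x ∈ cubeExt (side P.L M n) a 0 ∧ cover P x = y := by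
    intro y hy
    obtain ⟨x, hx, rfl⟩ := hy
    simp only [Nat.zero_mul, Nat.cast_zero] at hx
    exact ⟨x, hx, rfl⟩
  have himage : ∀ y, y ∈ cubeEnl P (side P.L M n) a 0 → y ∈ cover P '' cubeExt (side P.L M n) a 0 := fun y hy => by
    obtain ⟨x, hx, rfl⟩ := hlift y hy; exact ⟨x, hx, rfl⟩
  refine ⟨u, A, fun b hb => ?_, fun b hb => ?_, fun q hq => ?_, fun b hb => ?_, fun b hb => ?_, A', hA, h5⟩
  · obtain ⟨x, hx, hxs⟩ := hlift b.src hb.1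
    have hx' : x + e b.dir ∈ cubeExt (side P.L M n) a 0 :=
      add_e_mem_cubeExt_of_shift_mem_image hSN hx (by rw [hxs]; exact himage _ hb.2)
    have hb' : b = ⟨cover P x, b.dir⟩ := by cases b; simp only at hxs; rw [hxs]
    rw [hb', hA x hx]
    have hgauge := h1 x b.dir (hbox hx) (hbox hx')
    rw [cfgExp_eq_expI] at hgauge
    rw [← hgauge]
    simp only [gaugeU, B7Prop1Explicit.gaugeAct, PBond.tgt, ← cover_add_e, hu x hx, hu (x + e b.dir) hx', hV, zdLift_apply]
  · obtain ⟨x, hx, hxs⟩ := hlift b.src hb.1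
    have hx' : x + e b.dir ∈ cubeExt (side P.L M n) a 0 :=
      add_e_mem_cubeExt_of_shift_mem_image hSN hx (by rw [hxs]; exact himage _ hb.2)
    have hb' : b = ⟨cover P x, b.dir⟩ := by cases b; simp only at hxs; rw [hxs]
    rw [hb', hA x hx]
    exact h2 x b.dir (hbox hx) (hbox hx')
  · obtain ⟨hq1, hq2, hq3, -⟩ := hq
    obtain ⟨x, hx, hxs⟩ := hlift q.1 hq1
    have hxμ : x + e q.2.1 ∈ cubeExt (side P.L M n) a 0 :=
      add_e_mem_cubeExt_of_shift_mem_image hSN hx (by rw [hxs]; exact himage _ hq2)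
    have hxν : x + e q.2.2 ∈ cubeExt (side P.L M n) a 0 :=
      add_e_mem_cubeExt_of_shift_mem_image hSN hx (by rw [hxs]; exact himage _ hq3)
    rw [grad, ← hxs, ← cover_add_e, hA x hx, hA (x + e q.2.1) hxμ, norm_smul, norm_inv, Complex.norm_real, Real.norm_eq_abs, abs_of_pos hηpos]
    calc (P.eta n)⁻¹ * ‖A' (x + e q.2.1) q.2.2 - A' x q.2.2‖ ≤ (P.eta n)⁻¹ * (2 * (P.eta n * r)) :=
          mul_le_mul_of_nonneg_left (h3 x q.2.1 q.2.2 (hbox hx) (hbox hxμ) (hbox hxν)) (inv_nonneg.2 hηpos.le)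
      _ = 2 * r := by field_simp
  · obtain ⟨hb1, hb2, hbν⟩ := hb
    obtain ⟨x, hx, hxs⟩ := hlift b.src hb1
    have hxμ : x + e b.dir ∈ cubeExt (side P.L M n) a 0 :=
      add_e_mem_cubeExt_of_shift_mem_image hSN hx (by rw [hxs]; exact himage _ hb2)
    have hstencil : ∀ ν, x + e ν ∈ cubeExt (side P.L M n) a 0 ∧ x - e ν ∈ cubeExt (side P.L M n) a 0 ∧
        x - e ν + e b.dir ∈ cubeExt (side P.L M n) a 0 := by
      intro ν
      obtain ⟨s1, s2, s3, s4⟩ := hbν ν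
      have hxν : x + e ν ∈ cubeExt (side P.L M n) a 0 :=
        add_e_mem_cubeExt_of_shift_mem_image hSN hx (by rw [hxs]; exact himage _ s1)
      have hxν' : x - e ν ∈ cubeExt (side P.L M n) a 0 :=
        sub_e_mem_cubeExt_of_unshift_mem_image hSN hx (by rw [hxs]; exact himage _ s2)
      have hxν'' : x - e ν + e b.dir ∈ cubeExt (side P.L M n) a 0 :=
        add_e_mem_cubeExt_of_shift_mem_image hSN hxν' (by
          rw [cover_sub_e, hxs, ← Site.unshift_shift_comm]
          exact himage _ s4)
      exact ⟨hxν, hxν', hxν''⟩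
    have hb' : b = ⟨cover P x, b.dir⟩ := by cases b; simp only at hxs; rw [hxs]
    rw [hb']
    show ‖Sect2.codiffCurlA (P.eta n) A (cover P x) b.dir‖ ≤ 2 * r
    rw [codiffCurlA_cover_eq_pdiv (P.eta n) hA hx hxμ hstencil]
    exact h4 x b.dir (hbox hx) (hbox hxμ) fun ν => ⟨hbox (hstencil ν).1, hbox (hstencil ν).2.1, hbox (hstencil ν).2.2⟩
  · obtain ⟨hb1, hb2, hbν⟩ := hb
    obtain ⟨x, hx, hxs⟩ := hlift b.src hb1
    have hxμ : x + e b.dir ∈ cubeExt (side P.L M n) a 0 :=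
      add_e_mem_cubeExt_of_shift_mem_image hSN hx (by rw [hxs]; exact himage _ hb2)
    have hstencil : ∀ ν, x + e ν ∈ cubeExt (side P.L M n) a 0 ∧ x - e ν ∈ cubeExt (side P.L M n) a 0 := by
      intro ν
      obtain ⟨s1, s2, -, -⟩ := hbν ν
      exact ⟨add_e_mem_cubeExt_of_shift_mem_image hSN hx (by rw [hxs]; exact himage _ s1),
        sub_e_mem_cubeExt_of_unshift_mem_image hSN hx (by rw [hxs]; exact himage _ s2)⟩
    have hb' : b = ⟨cover P x, b.dir⟩ := by cases b; simp only at hxs; rw [hxs]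
    rw [hb']
    show ‖∑ ν : Fin P.d, ((P.eta n : ℝ) : ℂ)⁻¹ •
        (grad (P.eta n) ν (fun y => A ⟨y, b.dir⟩) ((cover P x).unshift ν) - grad (P.eta n) ν (fun y => A ⟨y, b.dir⟩) (cover P x))‖ ≤ 2 * r
    rw [lap_cover_eq_covLap (P.eta n) hA hx hstencil]
    exact h4' x b.dir (hbox hx) (hbox hxμ) fun ν => ⟨hbox (hstencil ν).1, hbox (hstencil ν).2⟩

end PushDown

end Literature.MathematicalPhysics.QuantumFieldTheory.Balaban1983to89.Node00

end
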